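/-
Copyright: internal research formalization. Source text: G. Kempf, Instability in invariant theory,
Ann. of Math. 108 (1978), §2 (proof of Thm. 2.2: two parabolic subgroups contain a common maximal
torus — the Bruhat decomposition); R. A. Horn, C. R. Johnson, Matrix Analysis, 2nd ed., Thm. 3.5.11
(LPU factorization), via the tree's `LPUFactorization.lean`.
-/
import Mathlib
import Literature.LinearAlgebra.Matrix.LPUFactorization
import HarnessLib

/-!
# Bruhat decomposition relative to two weight orders: `g = p₂ · ŵ · p₁`

For a square matrix `g` of determinant `1` over a field `K`, indexed by a finite type `σ`, and two
real weight vectors `a₁, a₂ : σ → ℝ`, there are matrices `p₂ ∈ P(a₂)`, `p₁ ∈ P(a₁)` of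
determinant `1` and a SIGNED PERMUTATION matrix `ŵ = π.toPEquiv.toMatrix * diagonal ε`
(`ε j = ±1`) of determinant `1` with `g = p₂ · ŵ · p₁`, where
`P(a) = {p : p.BlockTriangular (toDual ∘ a)}` (entries `p i j = 0` whenever `a i < a j`: the
parabolic subgroup of the one-parameter subgroup `t ↦ diag(t^a)`).

This is the Bruhat decomposition `SL_σ = P(a₂) · W · P(a₁)` in the form used in Kempf's proof of
the uniqueness of the optimal destabilising flag (Kempf 1978, §2: two parabolics share a maximal
torus, so their weight vectors can be compared after a Weyl-group element). Proof: sort `σ`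
ascending by `a₂` (rows) and descending by `a₁` (columns), apply the LPU factorization
`A = L P U` (Horn–Johnson Thm. 3.5.11; tree `exists_unitLowerTriangular_mul_perm_mul_upperTriangular`)
to the reindexed matrix, reindex back (lower triangular in the ascending-`a₂` order is `P(a₂)`,
upper triangular in the descending-`a₁` order is `P(a₁)`), and fix the determinants with one sign.

## Contents (theorem-only)

* `exists_equiv_fin_lt_of_lt` — a finite type can be enumerated compatibly with any real weight
  (`a i < a j → e i < e j`).
* `blockTriangular_of_imp` — weakening the block structure along an implication of strict orders.
* `exists_parabolic_mul_signedPerm_mul_parabolic` — the decomposition.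

Consumer: `Literature/Computability/AlgebraicComplexity/KempfOptimalParabolicSL.lean` (programme
Kempf for `SL_σ` over any algebraically closed field, cell `val-lit`). Honest framing: linear
algebra; nothing here bears on any open problem.

## References

* [Kempf1978] G. R. Kempf, Ann. of Math. (2) 108 (1978), §2.
* [HornJohnson2013] R. A. Horn, C. R. Johnson, *Matrix Analysis*, 2nd ed., Thm. 3.5.11.
-/

open Matrix

namespace Literature.LinearAlgebra.Matrix

section Sorting

variable {σ : Type*} [Fintype σ]

/-- **Weight-compatible enumeration**: a finite type has a bijection with `Fin (card σ)` along
which a given real weight `a` is compatible with the order: `a i < a j → e i < e j` (sorting the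
index set by a weight vector — the first step of writing a parabolic subgroup `P(a)` in block form).
[cite: Kempf1978, §2] -/
theorem exists_equiv_fin_lt_of_lt (a : σ → ℝ) :
    ∃ e : σ ≃ Fin (Fintype.card σ), ∀ i j, a i < a j → e i < e j := by
  classical
  -- pull back the lexicographic order on `ℝ ×ₗ Fin (card σ)` along `i ↦ (a i, enum i)`
  let f : σ → Lex (ℝ × Fin (Fintype.card σ)) := fun i => toLex (a i, Fintype.equivFin σ i)
  have hf : Function.Injective f := fun i j h => by
    have h' : (a i, Fintype.equivFin σ i) = (a j, Fintype.equivFin σ j) := toLex.injective h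
    exact (Fintype.equivFin σ).injective (congrArg Prod.snd h')
  letI : LinearOrder σ := LinearOrder.lift' f hf
  refine ⟨(Fintype.orderIsoFinOfCardEq σ rfl).symm.toEquiv, fun i j hij => ?_⟩
  have hlt : i < j := by
    change f i < f j
    exact Prod.Lex.toLex_lt_toLex.2 (Or.inl hij)
  exact (Fintype.orderIsoFinOfCardEq σ rfl).symm.strictMono hlt

end Sorting

section Bruhat

variable {K : Type*} [Field K] {σ : Type*} [Fintype σ] [DecidableEq σ]

omit [Fintype σ] [DecidableEq σ] in
/-- Weakening a block-triangular structure: if `b' j < b' i` implies `b j < b i`, then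
`BlockTriangular b` implies `BlockTriangular b'` (a Borel of the sorted order lies in the parabolic
`P(a)`). [cite: Kempf1978, §2] -/
theorem blockTriangular_of_imp {α β : Type*} [LT α] [LT β] {M : Matrix σ σ K} {b : σ → α}
    {b' : σ → β} (hM : M.BlockTriangular b) (h : ∀ i j, b' j < b' i → b j < b i) :
    M.BlockTriangular b' :=
  fun _ _ hij => hM (h _ _ hij)

/-- **Bruhat decomposition relative to two weight orders** (Kempf 1978, §2; from the LPU
factorization, Horn–Johnson Thm. 3.5.11). For `g` of determinant `1` and weights
`a₁ a₂ : σ → ℝ` there are `p₂ ∈ P(a₂)`, `p₁ ∈ P(a₁)` (i.e. `p i j = 0` whenever `a i < a j`) of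
determinant `1`, a permutation `π` and signs `ε j = ±1` such that the signed permutation matrix
`ŵ = π.toPEquiv.toMatrix * diagonal ε` has determinant `1` and `g = p₂ * ŵ * p₁`.
[cite: Kempf1978, §2] -/
theorem exists_parabolic_mul_signedPerm_mul_parabolic (g : Matrix σ σ K) (hg : g.det = 1)
    (a₁ a₂ : σ → ℝ) :
    ∃ (p₂ p₁ : Matrix σ σ K) (π : Equiv.Perm σ) (ε : σ → K),
      p₂.BlockTriangular (OrderDual.toDual ∘ a₂) ∧ p₁.BlockTriangular (OrderDual.toDual ∘ a₁) ∧
      p₂.det = 1 ∧ p₁.det = 1 ∧ (∀ j, ε j = 1 ∨ ε j = -1) ∧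
      (π.toPEquiv.toMatrix * diagonal ε).det = 1 ∧
      g = p₂ * (π.toPEquiv.toMatrix * diagonal ε) * p₁ := by
  classical
  -- enumerations: rows ascending in `a₂`, columns descending in `a₁`
  obtain ⟨e₂, he₂⟩ := exists_equiv_fin_lt_of_lt a₂
  obtain ⟨e₁, he₁⟩ := exists_equiv_fin_lt_of_lt (fun j => -a₁ j)
  have he₁' : ∀ i j, a₁ i < a₁ j → e₁ j < e₁ i := fun i j hij => he₁ j i (by simpa using hij)
  -- LPU of the reindexed matrix
  set A : Matrix (Fin (Fintype.card σ)) (Fin (Fintype.card σ)) K := g.submatrix e₂.symm e₁.symm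
    with hA
  obtain ⟨L, U, ρ, hL, hLdiag, hU, hLPU⟩ :=
    exists_unitLowerTriangular_mul_perm_mul_upperTriangular A
  -- reindex back
  set p₂ : Matrix σ σ K := L.submatrix e₂ e₂ with hp₂
  set q₁ : Matrix σ σ K := U.submatrix e₁ e₁ with hq₁
  set π : Equiv.Perm σ := e₂.trans (ρ.trans e₁.symm) with hπ
  have hw : (ρ.toPEquiv.toMatrix : Matrix (Fin (Fintype.card σ)) (Fin (Fintype.card σ)) K).submatrix
      e₂ e₁ = (π.toPEquiv.toMatrix : Matrix σ σ K) := by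
    ext i j
    simp only [submatrix_apply, PEquiv.toMatrix_apply, Equiv.toPEquiv_apply, Option.mem_def,
      Option.some.injEq, hπ, Equiv.trans_apply, Equiv.symm_apply_eq]
  have hgdec : g = p₂ * π.toPEquiv.toMatrix * q₁ := by
    have h1 : g = A.submatrix e₂ e₁ := by
      rw [hA, submatrix_submatrix]; simp
    rw [h1, hLPU, ← hw, hp₂, hq₁, ← submatrix_mul_equiv (L * ρ.toPEquiv.toMatrix) U e₂ e₁ e₁,
      ← submatrix_mul_equiv L (ρ.toPEquiv.toMatrix) e₂ e₂ e₁]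
  -- triangularity transport
  have hp₂T : p₂.BlockTriangular (OrderDual.toDual ∘ a₂) := by
    have h := hL.submatrix (f := e₂)
    refine blockTriangular_of_imp (b := OrderDual.toDual ∘ e₂) h fun i j hij => ?_
    exact he₂ i j hij
  have hq₁T : q₁.BlockTriangular (OrderDual.toDual ∘ a₁) := by
    have h := hU.submatrix (f := e₁)
    refine blockTriangular_of_imp (b := id ∘ e₁) h fun i j hij => ?_
    exact he₁' i j hij
  -- determinants
  have hdetp₂ : p₂.det = 1 := by
    rw [hp₂, det_submatrix_equiv_self, det_of_lowerTriangular L hL]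
    exact Finset.prod_eq_one fun i _ => hLdiag i
  have hdetπ : (π.toPEquiv.toMatrix : Matrix σ σ K).det = (Equiv.Perm.sign π : K) := by
    rw [← Equiv.Perm.permMatrix, det_permutation]
  have hdet1 : (Equiv.Perm.sign π : K) * q₁.det = 1 := by
    have := congrArg Matrix.det hgdec
    rw [det_mul, det_mul, hdetp₂, one_mul, hdetπ, hg] at this
    exact this.symm
  -- fix the sign
  rcases Int.units_eq_one_or (Equiv.Perm.sign π) with hs | hs
  · -- sign `+1`: no correction
    refine ⟨p₂, q₁, π, fun _ => 1, hp₂T, hq₁T, hdetp₂, ?_, fun _ => Or.inl rfl, ?_, ?_⟩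
    · simpa [hs] using hdet1
    · rw [show (diagonal fun _ : σ => (1 : K)) = 1 from diagonal_one, mul_one, hdetπ, hs]; simp
    · rw [show (diagonal fun _ : σ => (1 : K)) = 1 from diagonal_one, mul_one]; exact hgdec
  · -- sign `-1`: flip one coordinate (σ is nonempty since a permutation has sign `-1`)
    have hne : Nonempty σ := by
      by_contra h
      rw [not_nonempty_iff] at h
      have : π = 1 := Subsingleton.elim _ _
      rw [this, Equiv.Perm.sign_one] at hs
      exact absurd hs (by decide)
    obtain ⟨j₀⟩ := hne
    let ε : σ → K := Function.update (fun _ => (1 : K)) j₀ (-1)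
    have hεsq : diagonal ε * diagonal ε = 1 := by
      rw [diagonal_mul_diagonal, ← diagonal_one]
      congr 1
      funext j
      by_cases hj : j = j₀
      · subst hj; simp [ε]
      · simp [ε, hj]
    have hdetε : (diagonal ε).det = -1 := by
      rw [det_diagonal, Finset.prod_eq_single j₀]
      · simp [ε]
      · intro j _ hj; simp [ε, hj]
      · intro h; exact absurd (Finset.mem_univ j₀) h
    refine ⟨p₂, diagonal ε * q₁, π, ε, hp₂T, (blockTriangular_diagonal ε).mul hq₁T, hdetp₂, ?_,
      fun j => ?_, ?_, ?_⟩
    · rw [det_mul, hdetε]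
      have : (Equiv.Perm.sign π : K) = -1 := by rw [hs]; simp
      rw [this] at hdet1
      linear_combination hdet1
    · by_cases hj : j = j₀
      · subst hj; exact Or.inr (by simp [ε])
      · exact Or.inl (by simp [ε, hj])
    · rw [det_mul, hdetπ, hdetε, hs]; simp
    · rw [Matrix.mul_assoc p₂ (π.toPEquiv.toMatrix * diagonal ε) (diagonal ε * q₁),
        Matrix.mul_assoc (π.toPEquiv.toMatrix) (diagonal ε) (diagonal ε * q₁),
        ← Matrix.mul_assoc (diagonal ε) (diagonal ε) q₁, hεsq, one_mul, ← Matrix.mul_assoc]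
      exact hgdec

/-! ### The decomposition inside `SpecialLinearGroup` -/

/-- For `A ∈ SL`, the coercion of the group inverse is the matrix inverse. [folklore] -/
private theorem coe_sl_inv_eq_inv (A : Matrix.SpecialLinearGroup σ K) :
    ((A⁻¹ : Matrix.SpecialLinearGroup σ K) : Matrix σ σ K) = (A : Matrix σ σ K)⁻¹ := by
  refine (Matrix.inv_eq_left_inv ?_).symm
  rw [← Matrix.SpecialLinearGroup.coe_mul, inv_mul_cancel, Matrix.SpecialLinearGroup.coe_one]

/-- **Bruhat decomposition relative to two weight orders, inside `SL_σ(K)`** (the form consumed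
by Kempf's optimal-parabolic argument): `g = p₂ · ŵ · p₁` with `p₂, p₂⁻¹ ∈ P(a₂)`,
`p₁, p₁⁻¹ ∈ P(a₁)`, and `ŵ = π.toPEquiv.toMatrix * diagonal ε` a signed permutation matrix
(`ε j ≠ 0`; `ŵ i j ≠ 0 → i = π⁻¹ j`, `ŵ⁻¹ i j ≠ 0 → i = π j`), all three in `SL`.
[cite: Kempf1978, §2] -/
theorem exists_sl_parabolic_mul_signedPerm_mul_parabolic (g : Matrix.SpecialLinearGroup σ K)
    (a₁ a₂ : σ → ℝ) :
    ∃ (p₂ ŵ p₁ : Matrix.SpecialLinearGroup σ K) (π : Equiv.Perm σ) (ε : σ → K),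
      (p₂ : Matrix σ σ K).BlockTriangular (OrderDual.toDual ∘ a₂) ∧
      ((p₂⁻¹ : Matrix.SpecialLinearGroup σ K) : Matrix σ σ K).BlockTriangular
        (OrderDual.toDual ∘ a₂) ∧
      (p₁ : Matrix σ σ K).BlockTriangular (OrderDual.toDual ∘ a₁) ∧
      ((p₁⁻¹ : Matrix.SpecialLinearGroup σ K) : Matrix σ σ K).BlockTriangular
        (OrderDual.toDual ∘ a₁) ∧
      (∀ j, ε j ≠ 0) ∧ ((ŵ : Matrix σ σ K) = π.toPEquiv.toMatrix * diagonal ε) ∧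
      (∀ i j, (ŵ : Matrix σ σ K) i j ≠ 0 → i = π.symm j) ∧
      (∀ i j, ((ŵ⁻¹ : Matrix.SpecialLinearGroup σ K) : Matrix σ σ K) i j ≠ 0 → i = π j) ∧
      g = p₂ * ŵ * p₁ := by
  classical
  obtain ⟨q₂, q₁, π, ε, hq₂, hq₁, hdq₂, hdq₁, hε, hdw, hg⟩ :=
    exists_parabolic_mul_signedPerm_mul_parabolic (g : Matrix σ σ K) g.det_coe a₁ a₂
  have hε0 : ∀ j, ε j ≠ 0 := fun j => by
    rcases hε j with h | h
    · rw [h]; exact one_ne_zero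
    · rw [h]; exact neg_ne_zero.mpr one_ne_zero
  refine ⟨⟨q₂, hdq₂⟩, ⟨π.toPEquiv.toMatrix * diagonal ε, hdw⟩, ⟨q₁, hdq₁⟩, π, ε, hq₂, ?_, hq₁, ?_,
    hε0, rfl, ?_, ?_, ?_⟩
  · rw [coe_sl_inv_eq_inv]
    letI : Invertible q₂ := Matrix.invertibleOfIsUnitDet q₂ (by rw [hdq₂]; exact isUnit_one)
    exact Matrix.blockTriangular_inv_of_blockTriangular hq₂
  · rw [coe_sl_inv_eq_inv]
    letI : Invertible q₁ := Matrix.invertibleOfIsUnitDet q₁ (by rw [hdq₁]; exact isUnit_one)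
    exact Matrix.blockTriangular_inv_of_blockTriangular hq₁
  · intro i j hij
    change (π.toPEquiv.toMatrix * diagonal ε : Matrix σ σ K) i j ≠ 0 at hij
    rw [Matrix.mul_diagonal, PEquiv.toMatrix_apply] at hij
    simp only [Equiv.toPEquiv_apply, Option.mem_def, Option.some.injEq] at hij
    by_cases h : π i = j
    · exact π.eq_symm_apply.mpr h
    · rw [if_neg h, zero_mul] at hij; exact absurd rfl hij
  · -- the inverse of the signed permutation is `diag(ε⁻¹) · π⁻¹`
    intro i j hij
    have hPP : ((π.symm.toPEquiv.toMatrix : Matrix σ σ K) * π.toPEquiv.toMatrix) = 1 := by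
      rw [← PEquiv.toMatrix_trans, ← Equiv.toPEquiv_trans, Equiv.symm_trans_self,
        Equiv.toPEquiv_refl, PEquiv.toMatrix_refl]
    have hDD : diagonal (fun i => (ε i)⁻¹) * diagonal ε = (1 : Matrix σ σ K) := by
      rw [diagonal_mul_diagonal, ← diagonal_one]
      congr 1; funext i; exact inv_mul_cancel₀ (hε0 i)
    have hinv : ((⟨π.toPEquiv.toMatrix * diagonal ε, hdw⟩⁻¹ : Matrix.SpecialLinearGroup σ K) :
        Matrix σ σ K) = diagonal (fun i => (ε i)⁻¹) * π.symm.toPEquiv.toMatrix := by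
      rw [coe_sl_inv_eq_inv]
      refine Matrix.inv_eq_left_inv ?_
      change diagonal (fun i => (ε i)⁻¹) * (π.symm.toPEquiv.toMatrix : Matrix σ σ K) *
        (π.toPEquiv.toMatrix * diagonal ε) = 1
      rw [Matrix.mul_assoc, ← Matrix.mul_assoc (π.symm.toPEquiv.toMatrix : Matrix σ σ K), hPP,
        Matrix.one_mul, hDD]
    change ((⟨π.toPEquiv.toMatrix * diagonal ε, hdw⟩⁻¹ : Matrix.SpecialLinearGroup σ K) :
        Matrix σ σ K) i j ≠ 0 at hij
    rw [hinv, Matrix.diagonal_mul, PEquiv.toMatrix_apply] at hij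
    simp only [Equiv.toPEquiv_apply, Option.mem_def, Option.some.injEq] at hij
    by_cases h : π.symm i = j
    · exact π.symm_apply_eq.mp h
    · rw [if_neg h, mul_zero] at hij; exact absurd rfl hij
  · exact Subtype.ext hg

end Bruhat

end Literature.LinearAlgebra.Matrix
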